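import Summits.NavierStokesRegularity.NavierStokesRegularity.Theorems.ScenarioCensusForward
import Summits.NavierStokesRegularity.NavierStokesRegularity.Theorems.SqueezeCycleSingularZoom
import Literature.Analysis.FluidPDE.KNSSLineInvariantLiouville
import HarnessLib

/-!
# Census row F1ax (coherent axis of the fast fluid) — part 1/2: directions, the criterion rows
# F1dir ⊆ F1ax, the split of row F1, and the axial / unidirectional Liouville theorems in `𝒦_C`

Re-homing (VERBATIM port, namespace adapted, docstrings completed) of ns-idea-3's LINE 8 «one-way top»
REV 2 (`pub/ideators/ns-idea-3/lines/one-way-top/line-one-way-top.lean`, sha16 `009ad199a5fdaef2`, 640 l.,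
rc 0, 0 sorry) ordered by the census lead (ns-census-lead g6, 2026-08-28T15:15Z) for the scenario census
of `NavierStokesRegularity` (cell `pub/ns-census`), typer seat `ns-census-typer-2` (generation 7).

Row F1 of the census («Type I · no symmetry · Clay class», `ScenarioCensus.Row_F1`) is OPEN.  The line
cuts it along the DIRECTION axis of the fast fluid (`dir v = ‖v‖⁻¹ • v`):
* `HasCoherentTop u T` — parabolic uniform continuity of the velocity DIRECTION on the top
  `{(t, x) : t₁ < t < T, Λ < ‖u t x‖}`; `HasCoherentAxis u T` — the same for the unoriented AXIS
  (directions `ε`-close up to sign, `axDist`);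
* criterion rows `Row_F1dir ⊆ Row_F1ax`: the frame of `Row_F1` verbatim + coherent top / axis ⇒ the
  solution extends past `T` — both PROVED in part 2 (`rowF1ax_holds`, `rowF1dir_holds`);
* residuals `TopCoherence` / `AxisCoherence` (maximal frame), with `TopCoherence ↔ Row_F1 ↔ AxisCoherence`
  (part 2);
* this part also proves the Liouville theorems `eq_zero_of_axial` / `eq_zero_of_unidirectional`: a Type-I
  ancient mild field (KNSS gauge `IsTypeIAncientMild C W`) with values in ONE line vanishes (classical
  `div = ∂_e φ = 0` ⇒ slices invariant along `e` ⇒ KNSS line-invariant Liouville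
  `Literature.Analysis.FluidPDE.apply_eq_apply_zero_of_invariant_along` ⇒ slice-constant ⇒ `0`).
Census keys are in part 2 (`ScenarioCensusRowF1ax.lean`).

Values are booked by the census lead, not by this file; NS regularity is NOT proved; no summit statement
is proved by this file.

## References

* G. Koch, N. Nadirashvili, G. Seregin, V. Šverák, Acta Math. 203 (2009) = arXiv:0709.3599, Thm 5.1, §6,
  Remark 6.1. [KochNadirashviliSereginSverak2009]
* Y. Giga, P.-Y. Hsu, Y. Maekawa, arXiv:1310.6471, Thm 1.2 (continuous alignment on the top).
  [GigaHsuMaekawa2014]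
* I. Kukavica, W. Rusin, M. Ziane, arXiv:1511.02807, Cor. 2.3. [KukavicaRusinZiane2017]
-/

set_option linter.dupNamespace false

noncomputable section

open MeasureTheory Set Function Filter TopologicalSpace Metric
open scoped Topology NNReal ENNReal InnerProductSpace RealInnerProductSpace

namespace Summit.NavierStokesRegularity.NavierStokesRegularity.Theorems.ScenarioCensus.OneWayTop

open Literature.Analysis Literature.Analysis.FluidPDE
open Summit.NavierStokesRegularity.NavierStokesRegularity.Theorems

/-- `ℝ³`. -/
abbrev E3 := EuclideanSpace ℝ (Fin 3)

/-! ## §0 Directions -/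

/-- The direction `v/‖v‖` of a vector (`0` for `v = 0`). (folklore) -/
def dir (v : E3) : E3 := ‖v‖⁻¹ • v

/-- `dir 0 = 0`. (folklore) -/
theorem dir_zero : dir 0 = 0 := by simp [dir]

/-- The direction of a nonzero vector is a unit vector. (folklore) -/
theorem norm_dir {v : E3} (hv : v ≠ 0) : ‖dir v‖ = 1 := by
  rw [dir, norm_smul, norm_inv, norm_norm, inv_mul_cancel₀ (norm_ne_zero_iff.2 hv)]

/-- `‖v‖ • dir v = v`. (folklore) -/
theorem norm_smul_dir (v : E3) : ‖v‖ • dir v = v := by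
  rcases eq_or_ne v 0 with rfl | hv
  · simp [dir]
  · rw [dir, smul_smul, mul_inv_cancel₀ (norm_ne_zero_iff.2 hv), one_smul]

/-- Positive multiples have the same direction. (folklore) -/
theorem dir_smul_of_pos {a : ℝ} (ha : 0 < a) (v : E3) : dir (a • v) = dir v := by
  rcases eq_or_ne v 0 with rfl | hv
  · simp [dir]
  · rw [dir, dir, norm_smul, Real.norm_eq_abs, abs_of_pos ha, smul_smul, mul_inv,
      mul_comm a⁻¹ ‖v‖⁻¹, mul_assoc, inv_mul_cancel₀ ha.ne', mul_one]

/-- `dir` is continuous away from `0`. (folklore) -/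
theorem continuousAt_dir {v : E3} (hv : v ≠ 0) : ContinuousAt dir v := by
  show ContinuousAt (fun w : E3 => ‖w‖⁻¹ • w) v
  exact ((continuous_norm.continuousAt).inv₀ (norm_ne_zero_iff.2 hv)).smul continuousAt_id


/-- **Unoriented angular distance** of two vectors: the distance of their directions up to sign. (folklore) -/
def axDist (v w : E3) : ℝ := min ‖dir v - dir w‖ ‖dir v + dir w‖

/-- The unoriented angular distance is at most the distance of the directions. (folklore) -/
theorem axDist_le_norm_dir_sub (v w : E3) : axDist v w ≤ ‖dir v - dir w‖ := min_le_left _ _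

/-- `axDist` is invariant under positive rescaling of both arguments. (folklore) -/
theorem axDist_smul_of_pos {a b : ℝ} (ha : 0 < a) (hb : 0 < b) (v w : E3) :
    axDist (a • v) (b • w) = axDist v w := by
  simp only [axDist, dir_smul_of_pos ha, dir_smul_of_pos hb]

/-- `axDist` is continuous at pairs of nonzero vectors. (folklore) -/
theorem continuousAt_axDist {v w : E3} (hv : v ≠ 0) (hw : w ≠ 0) :
    ContinuousAt (fun q : E3 × E3 => axDist q.1 q.2) (v, w) := by
  have h1 : ContinuousAt (fun q : E3 × E3 => dir q.1) (v, w) :=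
    ContinuousAt.comp (g := dir) (f := fun q : E3 × E3 => q.1) (x := (v, w))
      (continuousAt_dir hv) continuousAt_fst
  have h2 : ContinuousAt (fun q : E3 × E3 => dir q.2) (v, w) :=
    ContinuousAt.comp (g := dir) (f := fun q : E3 × E3 => q.2) (x := (v, w))
      (continuousAt_dir hw) continuousAt_snd
  exact (h1.sub h2).norm.min (h1.add h2).norm

/-! ## §1 Coherent top / coherent axis, the criterion rows F1dir ⊆ F1ax, the residuals, the split of `Row_F1` -/

/-- **Coherent top** («the fast fluid does not veer near `T`»): parabolic uniform continuity of the
velocity direction on the top `{Λ < ‖u‖}` near `T` — for every `ε > 0` there are `δ > 0`, a threshold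
`Λ` and a time `t₁ < T` such that two top points with `|t − t'| < δ²`, `‖x − x'‖ < δ` have `ε`-close
directions.  (Velocity analogue, on the velocity top, of the «continuous alignment» condition (CA) for
the vorticity direction: Giga–Hsu–Maekawa 2014 Thm 1.2; Constantin–Fefferman 1993.)
(refs: arXiv:1310.6471, Thm 1.2 and (CA) (p. 4)) -/
def HasCoherentTop (u : ℝ → E3 → E3) (T : ℝ) : Prop :=
  ∀ ε : ℝ, 0 < ε → ∃ δ : ℝ, 0 < δ ∧ ∃ Λ t₁ : ℝ, t₁ < T ∧
    ∀ t ∈ Ioo t₁ T, ∀ t' ∈ Ioo t₁ T, ∀ x x' : E3,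
      |t - t'| < δ ^ 2 → ‖x - x'‖ < δ → Λ < ‖u t x‖ → Λ < ‖u t' x'‖ →
        ‖dir (u t x) - dir (u t' x')‖ ≤ ε

/-- **Coherent axis** (rev 2; «the fast fluid does not change axis near `T`»): as `HasCoherentTop` but
for the UNORIENTED direction — nearby top points have directions `ε`-close UP TO SIGN (`axDist`), so
counter-streaming fast layers `u ≈ ±|u| e` are allowed.  The fixed-axis special case (`dir u → ±e₃` on
the top, i.e. small horizontal part of the fast fluid) is the `L^∞`/top endpoint of the «small
horizontal part» ε-regularity of Wang–Zhang 2014 and of the one-component Type-I dichotomy of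
Kukavica–Rusin–Ziane 2017, Cor. 2.3 (stated there for `L^q`, `3 ≤ q < ∞`).
(refs: arXiv:1511.02807, Cor. 2.3 (p. 4) and the [WZ) criterion quoted on p. 3] -/
def HasCoherentAxis (u : ℝ → E3 → E3) (T : ℝ) : Prop :=
  ∀ ε : ℝ, 0 < ε → ∃ δ : ℝ, 0 < δ ∧ ∃ Λ t₁ : ℝ, t₁ < T ∧
    ∀ t ∈ Ioo t₁ T, ∀ t' ∈ Ioo t₁ T, ∀ x x' : E3,
      |t - t'| < δ ^ 2 → ‖x - x'‖ < δ → Λ < ‖u t x‖ → Λ < ‖u t' x'‖ →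
        axDist (u t x) (u t' x') ≤ ε

/-- A coherent top is a coherent axis. (folklore) -/
theorem HasCoherentTop.hasCoherentAxis {u : ℝ → E3 → E3} {T : ℝ} (h : HasCoherentTop u T) :
    HasCoherentAxis u T := by
  intro ε hε
  obtain ⟨δ, hδ, Λ, t₁, ht₁, hmod⟩ := h ε hε
  exact ⟨δ, hδ, Λ, t₁, ht₁, fun t ht t' ht' x x' h1 h2 h3 h4 =>
    (axDist_le_norm_dir_sub _ _).trans (hmod t ht t' ht' x x' h1 h2 h3 h4)⟩

/-- The simplest coherent top: an **asymptotically one-way fast fluid** — the direction of `u` on the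
top converges to a fixed vector `e` as `Λ → ∞`, `t → T`. (folklore) -/
theorem hasCoherentTop_of_asymptoticDirection {u : ℝ → E3 → E3} {T : ℝ} (e : E3)
    (h : ∀ ε : ℝ, 0 < ε → ∃ Λ t₁ : ℝ, t₁ < T ∧
      ∀ t ∈ Ioo t₁ T, ∀ x : E3, Λ < ‖u t x‖ → ‖dir (u t x) - e‖ ≤ ε) :
    HasCoherentTop u T := by
  intro ε hε
  obtain ⟨Λ, t₁, ht₁, hΛ⟩ := h (ε / 2) (half_pos hε)
  refine ⟨1, one_pos, Λ, t₁, ht₁, fun t ht t' ht' x x' _ _ hx hx' => ?_⟩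
  calc ‖dir (u t x) - dir (u t' x')‖
      ≤ ‖dir (u t x) - e‖ + ‖e - dir (u t' x')‖ := norm_sub_le_norm_sub_add_norm_sub _ _ _
    _ ≤ ε / 2 + ε / 2 := add_le_add (hΛ t ht x hx) (by rw [norm_sub_rev]; exact hΛ t' ht' x' hx')
    _ = ε := by ring

/-- The simplest coherent axis which is not a coherent top: an **asymptotically axial fast fluid** —
`dir u → ±e` on the top (e.g. counter-streaming layers `u ≈ ±|u| e₃`: small horizontal part).
(folklore) -/
theorem hasCoherentAxis_of_asymptoticAxis {u : ℝ → E3 → E3} {T : ℝ} (e : E3)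
    (h : ∀ ε : ℝ, 0 < ε → ∃ Λ t₁ : ℝ, t₁ < T ∧
      ∀ t ∈ Ioo t₁ T, ∀ x : E3, Λ < ‖u t x‖ → min ‖dir (u t x) - e‖ ‖dir (u t x) + e‖ ≤ ε) :
    HasCoherentAxis u T := by
  intro ε hε
  obtain ⟨Λ, t₁, ht₁, hΛ⟩ := h (ε / 2) (half_pos hε)
  refine ⟨1, one_pos, Λ, t₁, ht₁, fun t ht t' ht' x x' _ _ hx hx' => ?_⟩
  have ha := min_le_iff.1 (hΛ t ht x hx)
  have hb := min_le_iff.1 (hΛ t' ht' x' hx')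
  set a := dir (u t x)
  set b := dir (u t' x')
  show min ‖a - b‖ ‖a + b‖ ≤ ε
  rcases ha with ha | ha <;> rcases hb with hb | hb
  · calc min ‖a - b‖ ‖a + b‖ ≤ ‖a - b‖ := min_le_left _ _
      _ = ‖(a - e) - (b - e)‖ := by congr 1; abel
      _ ≤ ‖a - e‖ + ‖b - e‖ := norm_sub_le _ _
      _ ≤ ε := by linarith
  · calc min ‖a - b‖ ‖a + b‖ ≤ ‖a + b‖ := min_le_right _ _
      _ = ‖(a - e) + (b + e)‖ := by congr 1; abel
      _ ≤ ‖a - e‖ + ‖b + e‖ := norm_add_le _ _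
      _ ≤ ε := by linarith
  · calc min ‖a - b‖ ‖a + b‖ ≤ ‖a + b‖ := min_le_right _ _
      _ = ‖(a + e) + (b - e)‖ := by congr 1; abel
      _ ≤ ‖a + e‖ + ‖b - e‖ := norm_add_le _ _
      _ ≤ ε := by linarith
  · calc min ‖a - b‖ ‖a + b‖ ≤ ‖a - b‖ := min_le_left _ _
      _ = ‖(a + e) - (b + e)‖ := by congr 1; abel
      _ ≤ ‖a + e‖ + ‖b + e‖ := norm_sub_le _ _
      _ ≤ ε := by linarith

/-- **Inhabitants** (vacuity check): a field of ONE fixed direction with non-negative amplitude —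
e.g. the unbounded `u t x = (T - t)⁻¹ • e₀` — has a coherent top; so `HasCoherentTop` (and a fortiori
`HasCoherentAxis`) is populated by fields that blow up at `T`, and the criterion rows below are genuine
restrictions on blow-ups (while the veering theorems show no Type-I Navier–Stokes blow-up satisfies them).
(folklore) -/
theorem hasCoherentTop_of_fixedDirection {u : ℝ → E3 → E3} {T : ℝ} (e₀ : E3) (a : ℝ → E3 → ℝ)
    (ha : ∀ t x, 0 ≤ a t x) (hu : ∀ t x, u t x = a t x • e₀) : HasCoherentTop u T := by
  intro ε hε
  refine ⟨1, one_pos, 0, T - 1, by linarith, fun t _ t' _ x x' _ _ hx hx' => ?_⟩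
  have key : ∀ (s : ℝ) (z : E3), 0 < ‖u s z‖ → dir (u s z) = dir e₀ := by
    intro s z h
    rcases (ha s z).eq_or_lt with h0 | hpos
    · exfalso
      rw [hu, ← h0, zero_smul, norm_zero] at h
      exact lt_irrefl _ h
    · rw [hu]
      exact dir_smul_of_pos hpos e₀
  rw [key t x hx, key t' x' hx', sub_self, norm_zero]
  exact hε.le

/-- Example inhabitant blowing up at `T`: `u t x = (T - t)⁻¹ • e₀` on `t < T` (amplitude clipped at `0`
for `t ≥ T`). (folklore) -/
example (T : ℝ) (e₀ : E3) : HasCoherentTop (fun t _ => max (T - t)⁻¹ 0 • e₀) T :=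
  hasCoherentTop_of_fixedDirection e₀ (fun t _ => max (T - t)⁻¹ 0) (fun _ _ => le_max_right _ _)
    fun _ _ => rfl

/-- **Criterion row F1dir** (Type I · no symmetry · Clay class · coherent top): the frame of
`ScenarioCensus.Row_F1` verbatim plus `HasCoherentTop u T` ⇒ extension past `T`.  PROVED below
(`rowF1dir_holds`). (refs: KochNadirashviliSereginSverak2009, §6 (arXiv:0709.3599); arXiv:1310.6471, Thm 1.2) -/
def Row_F1dir : Prop :=
  ∀ (ν T : ℝ), 0 < ν → 0 < T →
    ∀ (u : ℝ → E3 → E3) (p : ℝ → E3 → ℝ),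
    IsClassicalNSSolutionOn (Ico 0 T) ν 0 u p → IsLerayHopfOn T ν 0 (u 0) u →
    HasRapidSpatialDecay (u 0) → IsTypeIBlowup u T → HasCoherentTop u T →
    HasSmoothExtensionPast ν 0 u T

/-- **Criterion row F1ax** (rev 2; Type I · no symmetry · Clay class · coherent AXIS): the frame of
`ScenarioCensus.Row_F1` verbatim plus `HasCoherentAxis u T` ⇒ extension past `T`; contains F1dir.
PROVED below (`rowF1ax_holds`). (refs: KochNadirashviliSereginSverak2009, §6 (arXiv:0709.3599); arXiv:1511.02807, Cor. 2.3) -/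
def Row_F1ax : Prop :=
  ∀ (ν T : ℝ), 0 < ν → 0 < T →
    ∀ (u : ℝ → E3 → E3) (p : ℝ → E3 → ℝ),
    IsClassicalNSSolutionOn (Ico 0 T) ν 0 u p → IsLerayHopfOn T ν 0 (u 0) u →
    HasRapidSpatialDecay (u 0) → IsTypeIBlowup u T → HasCoherentAxis u T →
    HasSmoothExtensionPast ν 0 u T

/-- **Residual** (maximal frame): every Type-I Clay blow-up has a coherent top.  Typed so that
`TopCoherence ↔ Row_F1` (`topCoherence_iff_rowF1`); DECLARED ≡ row F1. -/
def TopCoherence : Prop :=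
  ∀ (ν T : ℝ), 0 < ν → 0 < T →
    ∀ (u : ℝ → E3 → E3) (p : ℝ → E3 → ℝ),
    IsMaximalSmoothSolution ν 0 u p T → IsLerayHopfOn T ν 0 (u 0) u →
    HasRapidSpatialDecay (u 0) → IsTypeIBlowup u T → HasCoherentTop u T

/-- **Residual, axis form** (rev 2; maximal frame): every Type-I Clay blow-up has a coherent axis.
`AxisCoherence ↔ Row_F1` (`axisCoherence_iff_rowF1`); DECLARED ≡ row F1. -/
def AxisCoherence : Prop :=
  ∀ (ν T : ℝ), 0 < ν → 0 < T →
    ∀ (u : ℝ → E3 → E3) (p : ℝ → E3 → ℝ),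
    IsMaximalSmoothSolution ν 0 u p T → IsLerayHopfOn T ν 0 (u 0) u →
    HasRapidSpatialDecay (u 0) → IsTypeIBlowup u T → HasCoherentAxis u T

/-- F1ax contains F1dir. (folklore) -/
theorem rowF1dir_of_rowF1ax (h : Row_F1ax) : Row_F1dir :=
  fun ν T hν hT u p hsol hLH hdec hTI hcoh => h ν T hν hT u p hsol hLH hdec hTI hcoh.hasCoherentAxis

/-- **The split**: criterion + residual ⇒ row F1 (by cases on extendability). (folklore) -/
theorem rowF1_of (hD : Row_F1dir) (hTC : TopCoherence) : ScenarioCensus.Row_F1 := by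
  unfold ScenarioCensus.Row_F1
  intro ν T hν hT u p hsol hLH hdec hTI
  by_contra hext
  exact hext (hD ν T hν hT u p hsol hLH hdec hTI (hTC ν T hν hT u p ⟨hsol, hext⟩ hLH hdec hTI))

/-- The split, axis form. (folklore) -/
theorem rowF1_of_ax (hD : Row_F1ax) (hAC : AxisCoherence) : ScenarioCensus.Row_F1 := by
  unfold ScenarioCensus.Row_F1
  intro ν T hν hT u p hsol hLH hdec hTI
  by_contra hext
  exact hext (hD ν T hν hT u p hsol hLH hdec hTI (hAC ν T hν hT u p ⟨hsol, hext⟩ hLH hdec hTI))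

/-- The residual is a consequence of the row (vacuously: under `Row_F1` no maximal solution is
Type I). (folklore) -/
theorem topCoherence_of_rowF1 (h : ScenarioCensus.Row_F1) : TopCoherence :=
  fun ν T hν hT u p hmax hLH hdec hTI => (hmax.2 (h ν T hν hT u p hmax.1 hLH hdec hTI)).elim

/-- The axis residual is a consequence of the row (vacuously, as for `topCoherence_of_rowF1`). (folklore) -/
theorem axisCoherence_of_rowF1 (h : ScenarioCensus.Row_F1) : AxisCoherence :=
  fun ν T hν hT u p hmax hLH hdec hTI => (hmax.2 (h ν T hν hT u p hmax.1 hLH hdec hTI)).elim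

/-! ## §2 Liouville theorems for axial / unidirectional Type-I ancient mild fields -/

/-- **Axial elements of `𝒦_C` vanish** (rev 2).  If a Type-I ancient mild field (Oseen gauge) takes
values in ONE line, `W(t, y) = ⟪W(t, y), e⟫ e` for a unit vector `e` (any sign), then `W ≡ 0` on `t < 0`:
the classical divergence of `φ e`, `φ = ⟪W, e⟫`, is `∂_e φ`, so each slice is invariant along `e`;
time-shifted, the field is a bounded ancient mild solution, so the KNSS line-invariant Liouville theorem
(`apply_eq_apply_zero_of_invariant_along`) makes every slice spatially constant, and slice-constant
elements of `𝒦_C` vanish (`IsTypeIAncientMild.eq_zero_of_slice_const`).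
(refs: KochNadirashviliSereginSverak2009, Thm 5.1, §6 and Remark 6.1 (arXiv:0709.3599 pp. 9–11)) -/
theorem eq_zero_of_axial {C : ℝ} {W : ℝ → E3 → E3} (hW : IsTypeIAncientMild C W)
    {e : E3} (he : ‖e‖ = 1) (hax : ∀ t < 0, ∀ y, W t y = ⟪W t y, e⟫ • e) :
    ∀ t < 0, ∀ y, W t y = 0 := by
  have he0 : e ≠ 0 := by
    intro h; rw [h, norm_zero] at he; exact zero_ne_one he
  -- (a) every slice is invariant along `e`
  have hinv : ∀ t < 0, ∀ (x : E3) (δ : ℝ), W t (x + δ • e) = W t x := by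
    intro t ht x δ
    set φ : E3 → ℝ := fun y => ⟪W t y, e⟫ with hφ
    have hφW : ∀ y, W t y = φ y • e := fun y => hax t ht y
    have hWd : Differentiable ℝ (W t) := (hW.contDiff_slice ht).differentiable (by simp)
    have hφd : Differentiable ℝ φ := hWd.inner ℝ (differentiable_const e)
    -- `∂_e φ = div (φ e) = div W(t) = 0`
    have hDφe : ∀ y, fderiv ℝ φ y e = 0 := by
      intro y
      set b := EuclideanSpace.basisFun (Fin 3) ℝ with hb
      have h0 : VectorCalculus.divergence (W t) y = 0 := hW.isDivFree ht y
      have hWφ : W t = fun z => φ z • e := funext hφW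
      rw [hWφ, divergence_eq_sum_inner_fderiv b, fderiv_smul_const (hφd y)] at h0
      simp only [ContinuousLinearMap.smulRight_apply, real_inner_smul_right] at h0
      calc fderiv ℝ φ y e = fderiv ℝ φ y (∑ i, ⟪b i, e⟫ • b i) := by rw [b.sum_repr' e]
        _ = ∑ i, fderiv ℝ φ y (b i) * ⟪b i, e⟫ := by
            rw [map_sum]
            refine Finset.sum_congr rfl fun i _ => ?_
            rw [map_smul, smul_eq_mul, mul_comm]
        _ = 0 := h0
    -- constancy of `φ` along the line `x + s e`
    have hD : ∀ s : ℝ, HasDerivAt (fun s : ℝ => φ (x + s • e)) (fderiv ℝ φ (x + s • e) ((1 : ℝ) • e)) s := by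
      intro s
      have h1 : HasDerivAt (fun s : ℝ => x + s • e) ((1 : ℝ) • e) s :=
        ((hasDerivAt_id s).smul_const e).const_add x
      exact (hφd (x + s • e)).hasFDerivAt.comp_hasDerivAt s h1
    have hg : Differentiable ℝ (fun s : ℝ => φ (x + s • e)) := fun s => (hD s).differentiableAt
    have hg' : ∀ s, deriv (fun s : ℝ => φ (x + s • e)) s = 0 := fun s => by
      rw [(hD s).deriv, one_smul]; exact hDφe _
    have hline : φ (x + δ • e) = φ x := by
      have h := is_const_of_deriv_eq_zero hg hg' δ 0
      simpa using h
    rw [hφW (x + δ • e), hφW x, hline]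
  -- (b) KNSS line-invariant Liouville on the time-shifted (bounded) fields: slices are constant
  have hconst : ∀ s < 0, ∀ x : E3, W s x = W s 0 := by
    intro s hs x
    have hδ : 0 < -s / 2 := by linarith
    have hV : IsBoundedAncientMildSolution 1 (fun t => W (t - -s / 2)) :=
      hW.isBoundedAncientMildSolution_sub hδ
    have hVc : ContinuousOn (uncurry fun t => W (t - -s / 2)) (Iio 0 ×ˢ univ) :=
      (hW.comp_sub_right hδ.le).continuousOn_uncurry
    have hVinv : ∀ t < 0, ∀ (x : E3) (δ : ℝ),
        (fun t => W (t - -s / 2)) t (x + δ • e) = (fun t => W (t - -s / 2)) t x :=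
      fun t ht x δ => hinv (t - -s / 2) (by linarith) x δ
    have key : W (s / 2 - -s / 2) x = W (s / 2 - -s / 2) 0 :=
      apply_eq_apply_zero_of_invariant_along he0 hV hVc hVinv (s / 2) (by linarith) x
    have e1 : s / 2 - -s / 2 = s := by ring
    rw [e1] at key
    exact key
  -- (c) slice-constant elements of `𝒦_C` vanish
  exact fun t ht y => hW.eq_zero_of_slice_const (b := fun s => W s 0) hconst ht y

/-- **Unidirectional elements of `𝒦_C` vanish** (rev 1 headline, now a corollary of
`eq_zero_of_axial`): `W = ‖W‖ • e` for one unit `e` ⇒ `W ≡ 0`.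
(refs: KochNadirashviliSereginSverak2009, Thm 5.1 and §6 (arXiv:0709.3599)) -/
theorem eq_zero_of_unidirectional {C : ℝ} {W : ℝ → E3 → E3} (hW : IsTypeIAncientMild C W)
    {e : E3} (he : ‖e‖ = 1) (hdir : ∀ t < 0, ∀ y, W t y = ‖W t y‖ • e) :
    ∀ t < 0, ∀ y, W t y = 0 :=
  eq_zero_of_axial hW he fun t ht y => by
    have hi : ⟪‖W t y‖ • e, e⟫ = ‖W t y‖ := by
      rw [real_inner_smul_left, real_inner_self_eq_norm_sq, he]; ring
    conv_rhs => rw [hdir t ht y, hi]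
    exact hdir t ht y

end Summit.NavierStokesRegularity.NavierStokesRegularity.Theorems.ScenarioCensus.OneWayTop

end
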